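import Summits.BirchSwinnertonDyer.BirchSwinnertonDyer.Theorems.SignedLowerHalvesSmallImageLowerHalfBothSignsValveDepletion
import Literature.NumberTheory.EllipticCurves.HasseWeilAbelianBadReduction
import Literature.NumberTheory.DiophantineGeometry.LocalReduction
import HarnessLib

/-!
# Route `SignedLowerHalves`, crux L `SmallImageLowerHalfBothSigns` (item stmt-BirchSwinnertonDyer-23599), line `rtt_w3` — crux idea `valve`:
# the one-sign analytic `μ = 0` floor of `W` from the CM-side certificate B1 ALONE (brick B2 discharged)

Width seat `bsd-line-slh-p3-w3` g15 under LEAD `cruxlead-stmt-BirchSwinnertonDyer-23599` (cell `bsd-ssimc`); ROUTE-INDEPENDENT helper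
(`--supports stmt-BirchSwinnertonDyer-23599`); THEOREMS ONLY (no definition, no named fact, no `sorry`); closes nothing; BSD / crux L / crux M
are proved for NO curve by this. Composition of `…ValveKernel` (p758736: kernel K), `…ValveDepletionAlgebra` (p759591) and `…ValveDepletion`
(brick B2 = `exists_norm_depletedSymbol_eq_one`): the body of the floor stub `stub_muOneSign_ns_ge5` at `(W, p, f)` —
`∃ ε L, IsSignedPAdicLFunction f p ε L ∧ HasUnitContent L` — follows from

* the OUTPUT of Vatsal's congruence at a depleted pair `(f₁, g₁)` of common level (canonical periods `Ωf, Ωg`: integral, congruent, `f₁` a unit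
  somewhere) whose depletion identity is an `S₀`-EULER-FACTOR family: `φ_{f₁}(x) = Σ_{k : ι → {0,1,2}} (∏_i [X^{k_i}]P_i · ℓ_i^{−k_i}) · φ_f(∏_i ℓ_i^{k_i} · x)`
  for integers `ℓ_i > 1` prime to `p` and `P_i ∈ ℤ[X]` with `P_i(0) = 1` (the K-chain's shape, `…RttKanLayerDepletionExact`), and
* brick B1 (UNFOLDED): a unit Teichmüller-orbit sum of `g₁` in SOME integral rescaling of `φ_{g₁}/Ωg` — class-wide = wall W2 (cyclotomic one-sign
  `μ = 0` of the partner CM newform at the INERT prime), per pair a finite computation.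

§1 `exists_norm_teichOrbitSum_eq_one_of_valve_family` — the kernel with the depletion datum as an indexed family. §2 ★ `muOneSign_body_of_orbitUnitCert`.
References: [Vatsal1999] Thm. (1.13), Rem. (1.12); [GreenbergVatsal2000] §1 (8)–(9), §3 Rem. (3.4); [MazurTateTeitelbaum1986Invent] §I.4, §I.10; [Pollack2003] Conj. 6.3.
-/

set_option autoImplicit false
-- D-0017: single-problem summit, the namespace repeats the problem name by design.
set_option linter.dupNamespace false
noncomputable section

open scoped Classical MatrixGroups ModularForm
open Polynomial CongruenceSubgroup Literature.NumberTheory.EllipticCurves Literature.NumberTheory.EllipticCurves.ModularForms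
  Literature.NumberTheory.EllipticCurves.Kobayashi2003 Literature.NumberTheory.EllipticCurves.GreenbergVatsal2000
  Literature.NumberTheory.EllipticCurves.Rank1Residual Literature.NumberTheory.GaloisRepresentations
  Summit.BirchSwinnertonDyer.BirchSwinnertonDyer.Theorems.SmallImageHeckePrimeMu

namespace Summit.BirchSwinnertonDyer.BirchSwinnertonDyer.Theorems.SmallImageValve

open Summit.BirchSwinnertonDyer.BirchSwinnertonDyer.Theorems.SmallImageOrbitSumMu (exists_sign_hasUnitContent_of_norm_coeff_eq_one)
open Summit.BirchSwinnertonDyer.BirchSwinnertonDyer.Theorems.SmallImageTeichOrbitMu (teichOrbitSum_eq_coeff_comp_mazurTateElement norm_teichOrbitSum_le_one)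

variable {p : ℕ} [Fact p.Prime] {N M : ℕ} [NeZero N] [NeZero M]

/-! ## §1 The kernel with an indexed depletion family -/

omit [NeZero M] in
/-- **Kernel, orbit-sum form, depletion datum as an indexed FAMILY** (`(c_j, m_j)_{j ∈ s}` instead of a set of pairs; same proof as
`exists_norm_teichOrbitSum_eq_one_of_valve`). At an odd prime `p ∤ N` with `a_p(f) = 0` (integrality of orbit sums), for the newform
`f` of `W`, an eigenform pair `(f₁, g₁)` of common level with the OUTPUT of `vatsal1999_plusSymbol_congruence`
(canonical periods `Ωf, Ωg`: integral, congruent, `f₁`-side unit somewhere), a depletion datum `J` expressing `φ_{f₁}`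
through `φ_f`, brick B2 for `(f, J)` and brick B1 for `(g₁, Ωg)`: SOME Teichmüller-orbit sum of `f` itself at a level
`pⁿ`, `n ≥ 1`, is a `p`-adic unit. Proof = §1: unit point transfers `f₁ → g₁` (congruence); the valve makes the B1
rescaling a unit and the canonical `g₁`-orbit sum a unit; congruence moves it to `f₁`; on the `W` side `c_f = ι⁻¹(Ωf/Ω⁺_f)`
has `‖c_f‖ ≤ 1` (integrality of `[a/pⁿ]⁺_f`, tree) and `‖c_f‖ ≥ 1` (B2: a unit value of the `Ω⁺_f`-normalised depleted
symbol), so the `Ω⁺_f`-normalised depleted orbit sum is a unit; dilation + pigeonhole un-deplete it.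
[cite: Vatsal1999, Thm. (1.13) and Remark (1.12)] [cite: MazurTateTeitelbaum1986Invent, §I.10 (10.1)] -/
theorem exists_norm_teichOrbitSum_eq_one_of_valve_family {W : WeierstrassCurve ℚ} [W.IsElliptic] {κ : Type*}
    {f : CuspForm (Gamma0 N) 2} (hp2 : p ≠ 2) (hf : IsNewformOf W f) (hpN : ¬ p ∣ N)
    (hap : cuspCoeff f p = ((0 : ℤ) : ℂ))
    (ι : PadicAlgCl p ≃+* ℂ) (f₁ g₁ : CuspForm (Gamma0 M) 2) {Ωf Ωg : ℂ} (hΩf : Ωf ≠ 0)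
    (hVf : ∀ x : ℚ, Valued.v (ι.symm (plusSymbol f₁ x / Ωf)) ≤ 1)
    (hVg : ∀ x : ℚ, Valued.v (ι.symm (plusSymbol g₁ x / Ωg)) ≤ 1)
    (hVc : ∀ x : ℚ, Valued.v (ι.symm (plusSymbol f₁ x / Ωf - plusSymbol g₁ x / Ωg)) < 1)
    (hVu : ∃ x : ℚ, Valued.v (ι.symm (plusSymbol f₁ x / Ωf)) = 1)
    (s : Finset κ) (cJ : κ → ℚ) (mJ : κ → ℕ) (hJ : ∀ j ∈ s, ‖((cJ j : ℚ) : ℚ_[p])‖ ≤ 1 ∧ ¬ p ∣ mJ j)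
    (hdep : ∀ x : ℚ, plusSymbol f₁ x = ∑ j ∈ s, ((cJ j : ℚ) : ℂ) * plusSymbol f ((mJ j : ℚ) * x))
    (hB2 : ∃ x : ℚ, ‖((∑ j ∈ s, cJ j * ratPlusSymbol f ((mJ j : ℚ) * x) : ℚ) : ℚ_[p])‖ = 1)
    (hB1 : ∃ c : PadicAlgCl p, (∀ x : ℚ, ‖c * ι.symm (plusSymbol g₁ x / Ωg)‖ ≤ 1) ∧
      ∃ n : ℕ, 1 ≤ n ∧ ∃ b : (ZMod (p ^ n))ˣ,
        ‖∑ t ∈ (Finset.univ : Finset (ZMod (p ^ n))).filter (fun t => t ^ (p - 1) = 1),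
            c * ι.symm (plusSymbol g₁ ((((t * (b : ZMod (p ^ n))).val : ℕ) : ℚ) / (p : ℚ) ^ n) / Ωg)‖ = 1) :
    ∃ n : ℕ, 1 ≤ n ∧ ∃ b : (ZMod (p ^ n))ˣ, ‖((teichOrbitSum f p n (b : ZMod (p ^ n)) : ℚ) : ℚ_[p])‖ = 1 := by
  have hp : p.Prime := Fact.out
  have hf0 : IsNewform0 f := hf.1
  have hQ : coeffField f = ⊥ := hf.coeffField_eq_bot
  have hΩpos : 0 < plusPeriod f := IsNewform0.plusPeriod_pos_holds hf0 hQ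
  have hΩ : (plusPeriod f : ℂ) ≠ 0 := by exact_mod_cast hΩpos.ne'
  -- Vatsal's output in norm currency (`Valued.v z = ‖z‖₊` on `ℚ̄_p`); `‖q‖` of a rational read in `ℚ̄_p` is `‖q‖` in `ℚ_p`
  have hvf_le : ∀ x : ℚ, ‖ι.symm (plusSymbol f₁ x / Ωf)‖ ≤ 1 := fun x ↦ (PadicAlgCl.valuation_le_one_iff _).mp (hVf x)
  have hvg_le : ∀ x : ℚ, ‖ι.symm (plusSymbol g₁ x / Ωg)‖ ≤ 1 := fun x ↦ (PadicAlgCl.valuation_le_one_iff _).mp (hVg x)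
  have hvc : ∀ x : ℚ, ‖ι.symm (plusSymbol f₁ x / Ωf) - ι.symm (plusSymbol g₁ x / Ωg)‖ < 1 := fun x ↦ by
    rw [← map_sub, ← coe_nnnorm, ← NNReal.coe_one, NNReal.coe_lt_coe, ← PadicAlgCl.valuation_def]; exact hVc x
  obtain ⟨x₀, hx₀v⟩ := hVu
  have hx₀ : ‖ι.symm (plusSymbol f₁ x₀ / Ωf)‖ = 1 := (PadicAlgCl.valuation_eq_one_iff _).mp hx₀v
  have nrc : ∀ q : ℚ, ‖(q : PadicAlgCl p)‖ = ‖(q : ℚ_[p])‖ := fun q ↦ by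
    rw [← map_ratCast (algebraMap ℚ_[p] (PadicAlgCl p)) q]; exact PadicAlgCl.norm_extends p _
  -- B1 + the valve on the CM side + congruence: the canonical `f₁`-orbit sum is a unit
  obtain ⟨c, hcint, n, hn, b, hunit⟩ := hB1
  have hSf : ‖∑ t ∈ (Finset.univ : Finset (ZMod (p ^ n))).filter (fun t => t ^ (p - 1) = 1),
      ι.symm (plusSymbol f₁ ((((t * (b : ZMod (p ^ n))).val : ℕ) : ℚ) / (p : ℚ) ^ n) / Ωf)‖ = 1 :=
    unit_sum_transfer (vf := fun x ↦ ι.symm (plusSymbol f₁ x / Ωf)) (vg := fun x ↦ ι.symm (plusSymbol g₁ x / Ωg))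
      hvf_le hvg_le hvc hx₀ hcint _ (fun t ↦ (((t * (b : ZMod (p ^ n))).val : ℕ) : ℚ) / (p : ℚ) ^ n) hunit
  -- the W side: `c_f · (φ_{f₁}/Ωf) = dep` with `c_f = ι⁻¹(Ωf/Ω⁺_f)`, `dep x = Σ_j c_j [m_j x]⁺_f` the depleted symbol
  have hdepΩ : ∀ x : ℚ, plusSymbol f₁ x =
      ((∑ j ∈ s, cJ j * ratPlusSymbol f ((mJ j : ℚ) * x) : ℚ) : ℂ) * (plusPeriod f : ℂ) := by
    intro x
    rw [hdep x]
    push_cast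
    rw [Finset.sum_mul]
    refine Finset.sum_congr rfl fun j _ ↦ ?_
    rw [← ratCast_ratPlusSymbol_mul_plusPeriod f hf0 hQ ((mJ j : ℚ) * x)]
    ring
  have hcf_ne : ι.symm (Ωf / (plusPeriod f : ℂ)) ≠ 0 :=
    (map_ne_zero ι.symm).mpr (div_ne_zero hΩf hΩ)
  have hcfv : ∀ x : ℚ, ι.symm (Ωf / (plusPeriod f : ℂ)) * ι.symm (plusSymbol f₁ x / Ωf) =
      ((∑ j ∈ s, cJ j * ratPlusSymbol f ((mJ j : ℚ) * x) : ℚ) : PadicAlgCl p) := by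
    intro x
    rw [← map_mul, ← map_ratCast ι.symm (∑ j ∈ s, cJ j * ratPlusSymbol f ((mJ j : ℚ) * x))]
    congr 1
    rw [hdepΩ x]
    set d : ℚ := ∑ j ∈ s, cJ j * ratPlusSymbol f ((mJ j : ℚ) * x)
    field_simp
  -- integrality of the depleted symbol at the orbit's cusps (tree: `‖[a/pⁿ]⁺_f‖ ≤ 1` when `a_p = 0`)
  have hdep_le : ∀ t : ZMod (p ^ n),
      ‖((∑ j ∈ s, cJ j * ratPlusSymbol f ((mJ j : ℚ) * ((((t * (b : ZMod (p ^ n))).val : ℕ) : ℚ) / (p : ℚ) ^ n)) : ℚ) : ℚ_[p])‖ ≤ 1 := by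
    intro t
    push_cast
    refine IsUltrametricDist.norm_sum_le_of_forall_le_of_nonneg zero_le_one fun j hj ↦ ?_
    rw [norm_mul]
    refine mul_le_one₀ (hJ j hj).1 (norm_nonneg _) ?_
    have h := norm_ratPlusSymbol_intCast_div_pow_le_one f hp2 hf0 hpN hap
      (((mJ j * (t * (b : ZMod (p ^ n))).val : ℕ) : ℤ)) n
    have harg : (mJ j : ℚ) * ((((t * (b : ZMod (p ^ n))).val : ℕ) : ℚ) / (p : ℚ) ^ n) =
        ((((mJ j * (t * (b : ZMod (p ^ n))).val : ℕ) : ℤ) : ℚ)) / (p : ℚ) ^ n := by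
      push_cast; ring
    rwa [harg]
  obtain ⟨x₁, hx₁⟩ := hB2
  have hx₁' : ‖ι.symm (Ωf / (plusPeriod f : ℂ)) * ι.symm (plusSymbol f₁ x₁ / Ωf)‖ = 1 := by
    rw [hcfv, nrc]; exact hx₁
  have hsum_eq : (∑ t ∈ (Finset.univ : Finset (ZMod (p ^ n))).filter (fun t => t ^ (p - 1) = 1),
      ((∑ j ∈ s, cJ j * ratPlusSymbol f ((mJ j : ℚ) * ((((t * (b : ZMod (p ^ n))).val : ℕ) : ℚ) / (p : ℚ) ^ n)) : ℚ) : PadicAlgCl p)) =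
      ι.symm (Ωf / (plusPeriod f : ℂ)) * ∑ t ∈ (Finset.univ : Finset (ZMod (p ^ n))).filter (fun t => t ^ (p - 1) = 1),
        ι.symm (plusSymbol f₁ ((((t * (b : ZMod (p ^ n))).val : ℕ) : ℚ) / (p : ℚ) ^ n) / Ωf) := by
    rw [Finset.mul_sum]
    exact Finset.sum_congr rfl fun t _ ↦ (hcfv _).symm
  have hle : ‖ι.symm (Ωf / (plusPeriod f : ℂ)) * ∑ t ∈ (Finset.univ : Finset (ZMod (p ^ n))).filter (fun t => t ^ (p - 1) = 1),
        ι.symm (plusSymbol f₁ ((((t * (b : ZMod (p ^ n))).val : ℕ) : ℚ) / (p : ℚ) ^ n) / Ωf)‖ ≤ 1 := by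
    rw [← hsum_eq]
    refine IsUltrametricDist.norm_sum_le_of_forall_le_of_nonneg zero_le_one fun t _ ↦ ?_
    rw [nrc]; exact hdep_le t
  have hcf1 : ‖ι.symm (Ωf / (plusPeriod f : ℂ))‖ = 1 :=
    norm_eq_one_of_unit_somewhere hSf hle (hvf_le x₁) hx₁'
  -- the `Ω⁺_f`-normalised depleted orbit sum is a unit
  have hSdep : ‖((∑ t ∈ (Finset.univ : Finset (ZMod (p ^ n))).filter (fun t => t ^ (p - 1) = 1),
      ∑ j ∈ s, cJ j * ratPlusSymbol f ((mJ j : ℚ) * ((((t * (b : ZMod (p ^ n))).val : ℕ) : ℚ) / (p : ℚ) ^ n)) : ℚ) : ℚ_[p])‖ = 1 := by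
    rw [← nrc, Rat.cast_sum, hsum_eq, norm_mul, hcf1, hSf, one_mul]
  -- un-deplete: swap the sums, dilate, pigeonhole
  have hswap : (∑ t ∈ (Finset.univ : Finset (ZMod (p ^ n))).filter (fun t => t ^ (p - 1) = 1),
      ∑ j ∈ s, cJ j * ratPlusSymbol f ((mJ j : ℚ) * ((((t * (b : ZMod (p ^ n))).val : ℕ) : ℚ) / (p : ℚ) ^ n)) : ℚ) =
      ∑ j ∈ s, cJ j * teichOrbitSum f p n ((mJ j : ZMod (p ^ n)) * (b : ZMod (p ^ n))) := by
    rw [Finset.sum_comm]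
    refine Finset.sum_congr rfl fun j _ ↦ ?_
    rw [← Finset.mul_sum, sum_ratPlusSymbol_mul_eq_teichOrbitSum]
  rw [hswap] at hSdep
  push_cast at hSdep
  obtain ⟨j, hj, hone⟩ := exists_norm_eq_one_of_norm_sum_mul_eq_one
    (c := fun j : κ ↦ ((cJ j : ℚ) : ℚ_[p]))
    (S := fun j : κ ↦ ((teichOrbitSum f p n ((mJ j : ZMod (p ^ n)) * (b : ZMod (p ^ n))) : ℚ) : ℚ_[p]))
    (fun j hj ↦ (hJ j hj).1) (fun j _ ↦ norm_teichOrbitSum_le_one f hp2 hf0 hpN hap n _) hSdep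
  -- the dilated parameter is again a unit mod `pⁿ`
  have hcop : Nat.Coprime (mJ j) (p ^ n) :=
    Nat.Coprime.pow_right n ((Nat.Prime.coprime_iff_not_dvd hp).mpr (hJ j hj).2).symm
  exact ⟨n, hn, ZMod.unitOfCoprime (mJ j) hcop * b, by rw [Units.val_mul, ZMod.coe_unitOfCoprime]; exact hone⟩


/-! ## §2 The floor from B1 alone -/

omit [NeZero M] in
/-- ★ **The one-sign analytic `μ = 0` floor at `(W, p, f)` from the CM-side certificate B1 ALONE** (brick B2 of card `valve` DISCHARGED by
`exists_norm_depletedSymbol_eq_one`). Data: `W/ℚ` elliptic, globally minimal, `p` odd of good supersingular reduction (`a_p(W) = 0`), `f` a newform of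
`W`; a depleted pair `(f₁, g₁)` on `Γ₀(M)` with the OUTPUT clauses of Vatsal's canonical-period congruence along `ι : ℚ̄_p ≃ ℂ` (`hVf hVg hVc hVu`);
the depletion identity of `f₁` as an EULER-FACTOR FAMILY over integers `ℓ_i > 1` prime to `p` with polynomials `P_i ∈ ℤ[X]`, `P_i(0) = 1`
(`hdep`); and B1 (`hB1`, unfolded): in some integral rescaling `c·ι⁻¹(φ_{g₁}/Ωg)` some Teichmüller-orbit sum at a level `pⁿ`, `n ≥ 1`, is a unit.
Conclusion: VERBATIM the body of LEAD stub `stub_muOneSign_ns_ge5` for `f`: `∃ ε L, IsSignedPAdicLFunction f p ε L ∧ HasUnitContent L`.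
[cite: Vatsal1999, Thm. (1.13) and Remark (1.12)] [cite: GreenbergVatsal2000, §3 Remark (3.4)] [cite: MazurTateTeitelbaum1986Invent, §I.10 (10.1)] -/
theorem muOneSign_body_of_orbitUnitCert {W : WeierstrassCurve ℚ} [W.IsElliptic] [W.IsGloballyMinimal]
    {f : CuspForm (Gamma0 N) 2} (hp2 : p ≠ 2) (hf : IsNewformOf W f) (hgood : W.HasGoodReductionAtPrime p)
    (hap : W.frobeniusTrace p = 0)
    (ι : PadicAlgCl p ≃+* ℂ) (f₁ g₁ : CuspForm (Gamma0 M) 2) {Ωf Ωg : ℂ} (hΩf : Ωf ≠ 0)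
    (hVf : ∀ x : ℚ, Valued.v (ι.symm (plusSymbol f₁ x / Ωf)) ≤ 1)
    (hVg : ∀ x : ℚ, Valued.v (ι.symm (plusSymbol g₁ x / Ωg)) ≤ 1)
    (hVc : ∀ x : ℚ, Valued.v (ι.symm (plusSymbol f₁ x / Ωf - plusSymbol g₁ x / Ωg)) < 1)
    (hVu : ∃ x : ℚ, Valued.v (ι.symm (plusSymbol f₁ x / Ωf)) = 1)
    {κ : Type*} [Fintype κ] [DecidableEq κ] (ℓ : κ → ℕ) (hℓ : ∀ i, 1 < ℓ i ∧ ¬ p ∣ ℓ i) (P : κ → ℤ[X]) (hP0 : ∀ i, (P i).coeff 0 = 1)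
    (hdep : ∀ x : ℚ, plusSymbol f₁ x = ∑ k ∈ Fintype.piFinset (fun _ : κ ↦ Finset.range 3),
      (((∏ i, ((P i).coeff (k i) : ℚ) * ((ℓ i : ℚ) ^ (k i))⁻¹ : ℚ) : ℚ) : ℂ) * plusSymbol f (((∏ i, ℓ i ^ (k i) : ℕ) : ℚ) * x))
    (hB1 : ∃ c : PadicAlgCl p, (∀ x : ℚ, ‖c * ι.symm (plusSymbol g₁ x / Ωg)‖ ≤ 1) ∧
      ∃ n : ℕ, 1 ≤ n ∧ ∃ b : (ZMod (p ^ n))ˣ,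
        ‖∑ t ∈ (Finset.univ : Finset (ZMod (p ^ n))).filter (fun t => t ^ (p - 1) = 1),
            c * ι.symm (plusSymbol g₁ ((((t * (b : ZMod (p ^ n))).val : ℕ) : ℚ) / (p : ℚ) ^ n) / Ωg)‖ = 1) :
    ∃ (ε : ℤˣ) (L : IwasawaAlgebra p), IsSignedPAdicLFunction f p ε L ∧ HasUnitContent L := by
  have hp : p.Prime := Fact.out
  have hpN : ¬ p ∣ N := not_dvd_level_of_isNewformOf hf hgood
  have hap' : cuspCoeff f p = ((0 : ℤ) : ℂ) := by
    rw [cuspCoeff_eq_frobeniusTrace_of_isNewformOf_holds hf hgood, hap]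
  -- brick B2 for the Euler-factor family
  obtain ⟨n₀, a, -, hB2⟩ := exists_norm_depletedSymbol_eq_one hp2 hf hgood hap ℓ hℓ P hP0
  -- the family datum is `p`-integral with prime-to-`p` dilations
  have hJ : ∀ k ∈ Fintype.piFinset (fun _ : κ ↦ Finset.range 3),
      ‖(((∏ i, ((P i).coeff (k i) : ℚ) * ((ℓ i : ℚ) ^ (k i))⁻¹ : ℚ) : ℚ) : ℚ_[p])‖ ≤ 1 ∧ ¬ p ∣ ∏ i, ℓ i ^ (k i) := by
    intro k _
    refine ⟨?_, ?_⟩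
    · rw [Rat.cast_prod, norm_prod]
      refine Finset.prod_le_one (fun i _ ↦ norm_nonneg _) fun i _ ↦ ?_
      have hℓ1 : ‖((ℓ i : ℕ) : ℚ_[p])‖ = 1 :=
        Padic.norm_natCast_eq_one_iff.mpr ((Nat.Prime.coprime_iff_not_dvd hp).mpr (hℓ i).2)
      rw [Rat.cast_mul, Rat.cast_inv, Rat.cast_pow, Rat.cast_natCast, Rat.cast_intCast, norm_mul, norm_inv, norm_pow, hℓ1, one_pow,
        inv_one, mul_one]
      exact Padic.norm_int_le_one _
    · exact Prime.not_dvd_finsetProd (Nat.prime_iff.mp hp) fun i _ h ↦ (hℓ i).2 (hp.dvd_of_dvd_pow h)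
  obtain ⟨m, hm, b, hb1⟩ := exists_norm_teichOrbitSum_eq_one_of_valve_family hp2 hf hpN hap' ι f₁ g₁ hΩf hVf hVg hVc hVu
    (Fintype.piFinset (fun _ : κ ↦ Finset.range 3))
    (fun k ↦ (∏ i, ((P i).coeff (k i) : ℚ) * ((ℓ i : ℚ) ^ (k i))⁻¹ : ℚ)) (fun k ↦ ∏ i, ℓ i ^ (k i)) hJ hdep
    ⟨(a : ℚ) / (p : ℚ) ^ n₀, hB2⟩ hB1
  obtain ⟨n, rfl⟩ : ∃ n, m = n + 1 := ⟨m - 1, by omega⟩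
  obtain ⟨ξ₀, s, hb⟩ := exists_coe_eq_toZModPow_mul_pow hp2 n b
  have hs : s.val < p ^ n := by
    haveI : NeZero (p ^ n) := ⟨pow_ne_zero _ hp.ne_zero⟩
    exact ZMod.val_lt s
  rw [teichOrbitSum_eq_coeff_comp_mazurTateElement f hp2 n ξ₀ hs (b : ZMod (p ^ (n + 1))) hb] at hb1
  exact exists_sign_hasUnitContent_of_norm_coeff_eq_one hp2 hf hgood hap hb1

/-! ## §3 Brick B2 in the K-chain's currency (`S₀ ⊂` finite places of `ℚ`, `ℓ_v = natGenerator v`, `P_v = L_v(W, X)`) -/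

/-- **B2 for the `S₀`-depleted symbol of the K-chain** (`…RttKanLayerDepletionExact.depletedCurveLayer_eq_layerSum_depletedSymbol'`): for every
finite set `S₀` of finite places of `ℚ` not above `p`, SOME value `Σ_{k : S₀ → {0,1,2}} (∏_v [X^{k_v}]L_v(W,X) · ℓ_v^{−k_v}) · [(∏_v ℓ_v^{k_v}) a/p^n]⁺_f`
(`p ∤ a`) is a `p`-adic unit (`exists_norm_depletedSymbol_eq_one` with `ℓ_v` prime `≠ p` and `L_v(W, 0) = 1`).
[cite: GreenbergVatsal2000, §1 (8)–(9)] -/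
theorem exists_norm_depletedSymbol_eq_one_of_finset {W : WeierstrassCurve ℚ} [W.IsElliptic] [W.IsGloballyMinimal]
    {f : CuspForm (Gamma0 N) 2} (hp2 : p ≠ 2) (hf : IsNewformOf W f) (hgood : W.HasGoodReductionAtPrime p)
    (hap : W.frobeniusTrace p = 0) (S₀ : Finset (IsDedekindDomain.HeightOneSpectrum (NumberField.RingOfIntegers ℚ)))
    (hS : ∀ v ∈ S₀, Rat.HeightOneSpectrum.natGenerator v ≠ p) :
    ∃ (n : ℕ) (a : ℕ), ¬ p ∣ a ∧
      ‖((∑ k ∈ Fintype.piFinset (fun _ : S₀ ↦ Finset.range 3),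
          (∏ v : S₀, ((W.localPolynomialAt (v : IsDedekindDomain.HeightOneSpectrum (NumberField.RingOfIntegers ℚ))).coeff (k v) : ℚ) *
              ((Rat.HeightOneSpectrum.natGenerator (v : IsDedekindDomain.HeightOneSpectrum (NumberField.RingOfIntegers ℚ)) : ℚ) ^ (k v))⁻¹) *
            ratPlusSymbol f (((∏ v : S₀, Rat.HeightOneSpectrum.natGenerator
                (v : IsDedekindDomain.HeightOneSpectrum (NumberField.RingOfIntegers ℚ)) ^ (k v) : ℕ) : ℚ) *
              ((a : ℚ) / (p : ℚ) ^ n)) : ℚ) : ℚ_[p])‖ = 1 := by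
  have hp : p.Prime := Fact.out
  refine exists_norm_depletedSymbol_eq_one hp2 hf hgood hap
    (fun v : S₀ ↦ Rat.HeightOneSpectrum.natGenerator (v : IsDedekindDomain.HeightOneSpectrum (NumberField.RingOfIntegers ℚ)))
    (fun v ↦ ⟨(Rat.HeightOneSpectrum.prime_natGenerator _).one_lt, fun h ↦ hS v v.2
      ((Nat.prime_dvd_prime_iff_eq hp (Rat.HeightOneSpectrum.prime_natGenerator _)).mp h).symm⟩)
    (fun v : S₀ ↦ W.localPolynomialAt (v : IsDedekindDomain.HeightOneSpectrum (NumberField.RingOfIntegers ℚ)))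
    (fun v ↦ by
      -- `L_v(W, 0) = 1` in each reduction type
      rcases WeierstrassCurve.hasGoodReductionAt_or_hasMultiplicativeReductionAt_or_hasAdditiveReductionAt
          (v : IsDedekindDomain.HeightOneSpectrum (NumberField.RingOfIntegers ℚ)) W with hg | hm | ha
      · rw [WeierstrassCurve.localPolynomialAt_of_hasGoodReductionAt hg]; simp
      · by_cases hs : W.HasSplitMultiplicativeReductionAt (v : IsDedekindDomain.HeightOneSpectrum (NumberField.RingOfIntegers ℚ))
        · rw [WeierstrassCurve.localPolynomialAt_of_hasSplitMultiplicativeReductionAt hs]; simp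
        · rw [WeierstrassCurve.localPolynomialAt_of_hasMultiplicativeReductionAt_of_not_hasSplitMultiplicativeReductionAt hm hs]
          simp
      · rw [WeierstrassCurve.localPolynomialAt_of_hasAdditiveReductionAt ha]; simp)

end Summit.BirchSwinnertonDyer.BirchSwinnertonDyer.Theorems.SmallImageValve

end
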